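import Literature.AnabelianGeometry.EtaleTheta.ThetaTrivializationsClosures
import Literature.AnabelianGeometry.EtaleTheta.ThetaTrivializationsOfFunctions
import Literature.AnabelianGeometry.EtaleTheta.ThetaTrivializationsOfFunctionsLevel
import Literature.AnabelianGeometry.EtaleTheta.ThetaTrivializationsToy
import Literature.AnabelianGeometry.EtaleTheta.Discharge.Sec5Lem12AtSection5Reading
import Literature.AnabelianGeometry.EtaleTheta.Discharge.Sec2TemperedModelAutomorphisms
import Literature.AnabelianGeometry.EtaleTheta.Discharge.Sec2Prop24OfCore
import Literature.AnabelianGeometry.EtaleTheta.Discharge.Sec2Prop24TrueAtMonodromyModel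
import Literature.AnabelianGeometry.EtaleTheta.Discharge.Sec2Prop24Prop26ClosureRefuted
import Literature.AnabelianGeometry.EtaleTheta.SettingModelKrullCuspNotIsoPreservesCuspidal
import Literature.AnabelianGeometry.EtaleTheta.SettingModelChiOriginProfile
import Literature.AnabelianGeometry.EtaleTheta.SettingModelOriginProfile
import Literature.AnabelianGeometry.SemiGraphs.PSCGraphicityOriginClosure
import Literature.AnabelianGeometry.SemiGraphs.PSCSmoothProperOrigin
import Literature.AnabelianGeometry.SemiGraphs.PSCSmoothCurveShape
import Literature.AnabelianGeometry.SemiGraphs.PSCGraphicConverseAssembly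
import Literature.AnabelianGeometry.SemiGraphs.TemperedSpecialFibrePadicSchemaWitnesses
import Literature.AnabelianGeometry.SemiGraphs.TemperedSpecialFibreReductionsSchema
import Literature.AnabelianGeometry.SemiGraphs.TemperedSpecialFibreReductionsSchemaS3
import Literature.AnabelianGeometry.SemiGraphs.TemperedSpecialFibreCor311Instances
import Literature.AnabelianGeometry.SemiGraphs.ArithmeticCurvesEx56SchemaVerdicts
import Literature.AnabelianGeometry.SemiGraphs.ArithmeticCurvesEx56InstanceForms
import Literature.AnabelianGeometry.SemiGraphs.TemperedAnabelianMorphismsSchemaNegative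
import Literature.AnabelianGeometry.SemiGraphs.TemperedAnabelianThm64SubIdentityDatumNegative
import Literature.AnabelianGeometry.SemiGraphs.TemperedAnabelianThm64SubSchemas
import Literature.AnabelianGeometry.SemiGraphs.TemperedAnabelianThm64SubOuterDescentNegative
import Literature.AnabelianGeometry.SemiGraphs.TemperedAnabelianThm64SubIdentityDatum
import Literature.AnabelianGeometry.SemiGraphs.TemperedAnabelianThm64SubCompactCase
import Literature.AnabelianGeometry.SemiGraphs.TemperedAnabelianThm64OfTowerProofs
import Literature.AnabelianGeometry.SemiGraphs.TemperedOriginSchemaNegative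
import Literature.AnabelianGeometry.SemiGraphs.TemperedDecompositionOfProfinite
import Literature.AnabelianGeometry.SemiGraphs.TemperedCurveThm65iiiNegative
import Literature.AnabelianGeometry.SemiGraphs.TemperedCuspidalAbsolutenessOfCor311
import Literature.AnabelianGeometry.SemiGraphs.TemperedAnabelianTowerNecessity
import Literature.AnabelianGeometry.SemiGraphs.TemperedAnabelianThm66SubProofs
import Literature.AnabelianGeometry.SemiGraphs.TemperedDLocGenuineSchemaNegative
import Literature.AnabelianGeometry.SemiGraphs.TemperedAnabelianThm68OriginClosers
import Literature.AnabelianGeometry.SemiGraphs.TemperedDLocCategory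
import Literature.AnabelianGeometry.SemiGraphs.TemperedDLocEquivalenceSchemaNegative
import Literature.AnabelianGeometry.SemiGraphs.TemperedDLocTransportEquivalence
import Literature.AnabelianGeometry.SemiGraphs.TemperedTorsionPointsSchemaNegative
import Literature.AnabelianGeometry.AbsoluteAnabelian.AbsTopIChainsCuspidalFacts
import Literature.AnabelianGeometry.AbsoluteAnabelian.CuspidalDataNonProperIffFreeInstances
import Literature.AnabelianGeometry.AbsoluteAnabelian.AbsTopILem45iModelProofs
import Literature.AnabelianGeometry.AbsoluteAnabelian.AbsTopICharacterRankLem45iiiClosures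
import Literature.AnabelianGeometry.AbsoluteAnabelian.AbsTopICharacterRankSplitModel
import Literature.AnabelianGeometry.AbsoluteAnabelian.AbsTopICharacterRankCurveShape
import Literature.AnabelianGeometry.AbsoluteAnabelian.AbsTopIChainsSchemaClosures
import Literature.AnabelianGeometry.AbsoluteAnabelian.AbsTopICuspInertiaOfPSCSmoothCurve
import Literature.AnabelianGeometry.AbsoluteAnabelian.AbsTopIChainsRecoversCuspsInstances
import Literature.AnabelianGeometry.AbsoluteAnabelian.AbsTopIChainsCuspidalModelProofs
import Literature.AnabelianGeometry.AbsoluteAnabelian.AbsTopITemperedCuspsFactRows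
import Summits.ABC.ABC.Theses.IUTThetaPilot
import Literature.IUT.HodgeArakelov.BadPlaceSettingOfDoubleUnderline
import Literature.IUT.HodgeArakelov.TemperedCoveringsCharacteristic
import Literature.AnabelianGeometry.SemiGraphs.TemperedAnabelianThm64SubProofs
import Literature.AnabelianGeometry.SemiGraphs.TemperedSpecialFibreReductions
import Literature.AnabelianGeometry.SemiGraphs.TemperedCuspidalAbsolutenessOfProCusps
import Literature.AnabelianGeometry.SemiGraphs.TemperedAnabelianThm68Sub
import Literature.AnabelianGeometry.EtaleTheta.Discharge.Sec5Prop52iiSectionDefinedActions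
import Literature.AnabelianGeometry.SemiGraphs.TemperedTorsionPointsNonVacuity
import Literature.AnabelianGeometry.SemiGraphs.WitnessIwahoriCuspShear
import Literature.AnabelianGeometry.EtaleTheta.ThetaTrivializationsOfFunctionsModelChi
import Literature.AnabelianGeometry.AbsoluteAnabelian.AbsTopIGraphCuspidalNonVacuity
import Literature.AnabelianGeometry.EtaleTheta.Discharge.Sec2Prop26InstanceForms
import Literature.AnabelianGeometry.SemiGraphs.PSCGraphicitySmoothProperInstances
import Literature.AnabelianGeometry.SemiGraphs.TemperedDecompositionInternal
import Literature.AnabelianGeometry.AbsoluteAnabelian.AbsTopICuspInertiaOfPSCLem45iv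
import Literature.AnabelianGeometry.AbsoluteAnabelian.FreeProSigmaCompletionBridge
import Literature.AnabelianGeometry.AbsoluteAnabelian.FreeProSigmaNonVacuity
import Literature.AnabelianGeometry.SemiGraphs.TemperedCurveHyperbolicWitness
import Literature.AnabelianGeometry.SemiGraphs.TemperedDLocTypePreservedProofs
import Literature.AnabelianGeometry.AbsoluteAnabelian.AbsTopICharacterRankProperShape
import Literature.AnabelianGeometry.AbsoluteAnabelian.AbsTopICharacterRankPoincareExtension
import Literature.AnabelianGeometry.SemiGraphs.TemperedCurveDiscreteRankOneWitness
import Literature.IUT.LogThetaLattice.MultiradialityRemarksRmk212iiAtTemperedModels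
import Literature.AnabelianGeometry.EtaleTheta.Discharge.Sec2Prop26NoExtensionOfHatConj
import Literature.AnabelianGeometry.SemiGraphs.TemperedAnabelianThm68ivAssembly
import Literature.AnabelianGeometry.AbsoluteAnabelian.AbsTopITemperedCusps
import Literature.AnabelianGeometry.SemiGraphs.TemperedSpecialFibreInertiaTransport
import Literature.AnabelianGeometry.SemiGraphs.TemperedAnabelianThm64SubCoveringDatum
import Literature.AnabelianGeometry.SemiGraphs.TemperedCurvePuncturedDiscNonVacuity
import Literature.AnabelianGeometry.SemiGraphs.TemperedOriginCompletionSchemaNegative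
import Literature.AnabelianGeometry.AbsoluteAnabelian.AbsTopICharacterRankCyclotomicModel
import Literature.AnabelianGeometry.EtaleTheta.Discharge.Sec2Prop26FalseAtModelKrull
import Literature.AnabelianGeometry.SemiGraphs.PSCTwoTripodIncidence
import Literature.AnabelianGeometry.SemiGraphs.TemperedSec6OfSpecialFibreTowerEventually
import Literature.AnabelianGeometry.SemiGraphs.TemperedAnabelianSec6OfTowerProofs
import Literature.AnabelianGeometry.AbsoluteAnabelian.AbsTopIProp410iiNodeReclose
import Literature.AnabelianGeometry.SemiGraphs.TemperedAnabelianThm68OriginClosersCor69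
import Summits.ABC.IUTFork.LDHGenuinePerImageContentfulAll
import Literature.IUT.HodgeArakelov.ThetaSettingModelTateNotNormallyTerminal
import Literature.IUT.HodgeArakelov.ThetaSettingModelTateNotDeltaNormallyTerminal
import HarnessLib

/-!
# RESCUE-39 · PARTITION A (rows 1–20 of NEG-AS-TYPED-39.tsv) — Sketch (pins only)

Seat abc-iut-inv-4 (gen 1), CYCLE 3, lens `rescuer` (KEY `pub/abc-iut/wake/KEY-abc-iut-inv-4-RESCUER-39.md`,
sha16 d6d1fd236cfc3cd9).  Companion of HOME `pub/ideators/abc-iut-inv-4/RESCUE-39.md`.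

Contents: §1 pins BY NAME the refuting witness of every SCHEMA-REFUTED F-id of rows 1–20 (the «refuted AS
TYPED» column); §2 pins BY NAME the surviving instance forms / conditional closers / `iff`-repairs the
table cites (the «instance form suffices» / C′ column); §3 pins the tree facts the row-10 note rests on
(`h65` takes both truth values on the tree's semi-synthetic carriers); §4 pins every SECONDARY name the
memo's table cites (toy / junk witnesses, conditional closers, `iff` forms, consumer-side BY-NAME typings in
`Literature/IUT`); §5 pins the (P)-arm floor of record (ERRATUM g12-E1) the memo's §2 cites BY NAME.  Nothing is stated anew: 0 `def`,
0 `theorem`, 0 `instance`, 0 `notation`, 0 `sorry` — every line is `example := @<existing decl>`, so `lean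
check` rc 0 certifies exactly that the cited names exist with the cited owners.

HONESTY: no side taken on [IUTchIII] Cor 3.12 or any author; typed ≠ proved; every row is «refuted AS
TYPED» (universal closure of a schema over a free interface), never «[paper] is wrong»; NO abc claim.
The crux of record `Summit.ABC.ABC.Theses.IUTThetaPilot.ThetaPartII` (stmt-ABC-19678) is imported and
untouched.
-/

namespace Summit.ABC.ABC.Cruxes.ThetaPartII.Rescue39A

open Literature.AnabelianGeometry

/-! ## §0 The crux of record (untouched) -/

example := @Summit.ABC.ABC.Theses.IUTThetaPilot.ThetaPartII

/-! ## §1 Refuting witnesses of the ∀-closures, rows 1–20 (BY NAME) -/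

-- row 1 · EtTh:Lem1.2 · F-0653
example := @EtaleTheta.ThetaSetting.not_forall_lem12
-- row 2 · EtTh:Prop1.1(i) · F-0654
example := @EtaleTheta.ThetaSetting.not_forall_prop11i
-- row 3 · EtTh:Prop1.1(ii) · F-0655 (+ the conditional refuter at the functions-dictionary datum)
example := @EtaleTheta.ThetaSetting.not_forall_prop11ii
example := @EtaleTheta.ThetaSetting.ThetaKummerInput.not_prop11ii_lineBundleData
-- row 4 · EtTh:Prop2.4 · F-0603 (vocabulary `ExtendsStabilising`) and its consumer F-0609 `Prop24`
example := @EtaleTheta.ThetaCovers.TemperedModel.not_forall_extendsStabilising_three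
example := @EtaleTheta.ThetaCovers.TemperedModel.not_forall_extendsStabilising
example := @EtaleTheta.ThetaCovers.TemperedModel.exists_model_not_prop24_prop26
-- row 5 · CombGC:Prop1.5 · F-0440 / F-0442 / F-0443
example := @SemiGraphs.PSCDatum.not_edgeLikeIncidenceHolds_true
example := @SemiGraphs.PSCDatum.not_forall_edgeLikeIncidenceHolds
example := @SemiGraphs.PSCDatum.not_forall_graphicIffEdgeLikeVerticial
example := @SemiGraphs.PSCDatum.not_graphicIffEdgeLikeVerticialHolds_true
example := @SemiGraphs.PSCDatum.not_forall_graphicIffEdgeLikeVerticialHolds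
-- row 6 · SemiAnbd:Cor3.11 · F-1721 / F-1724 / F-1725 / F-1727
example := @SemiGraphs.not_forall_cor311
example := @SemiGraphs.not_forall_admissibleQuotientCompatible
example := @SemiGraphs.not_forall_residueCharOfTemperedIso
example := @SemiGraphs.not_forall_specialFibreIsoOfChartIso
-- row 7 · SemiAnbd:Ex5.6 · F-1449 / F-1450 / F-1451
example := @SemiGraphs.not_forall_ex56CompactRigidityStatement
example := @SemiGraphs.not_forall_ex56ObjectRecipeStatement
example := @SemiGraphs.not_forall_ex56PropertiesStatement
-- row 8 · SemiAnbd:Thm6.4 · F-1693 / F-2831 / F-2832 / F-2838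
example := @SemiGraphs.TemperedMorphismOrigin.not_forall_temperedAnabelianTheoremHolds
example := @SemiGraphs.TemperedCurve.not_geometricIsDFG_id_settingModel
example := @SemiGraphs.TemperedCurve.not_geometricIsGaloisCompatible_trivial
example := @SemiGraphs.not_forall_outerDescent
-- row 9 · SemiAnbd:Thm6.5(i) · F-1708
example := @SemiGraphs.TemperedCurve.not_forall_temperedDecompositionGroupsHolds
-- row 10 · SemiAnbd:Thm6.5(iii) · F-1704 (schema) / F-1674 (vocabulary `IsoPreservesCuspidalDecomp`)
example := @SemiGraphs.TemperedCurve.not_forall_cuspidalAbsolutenessHolds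
example := @SemiGraphs.exists_temperedCurve_not_isoPreservesCuspidalDecomp
-- row 11 · SemiAnbd:Thm6.6 · F-1707
example := @SemiGraphs.not_forall_profiniteOuterIsoLiftsHolds
-- row 12 · SemiAnbd:Thm6.8(i) · F-1681 / F-1698
example := @SemiGraphs.TemperedMorphismOrigin.not_forall_dLocGroupTheoreticityHolds
example := @SemiGraphs.TemperedMorphismOrigin.not_forall_dLocGroupTheoreticityGenuineHolds
-- row 13 · SemiAnbd:Thm6.8(ii) · F-1686
example := @SemiGraphs.TemperedCurve.not_forall_isoInducesDLocEquivalence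
-- row 14 · SemiAnbd:Thm6.8(iii) · F-1682 / F-1730
example := @SemiGraphs.TemperedMorphismOrigin.not_forall_decompositionPreservationHolds
example := @SemiGraphs.TemperedCurve.not_forall_torsionPointsHolds
-- row 15 · AbsTopI:Lem4.5(i) · F-0208
example := @AbsoluteAnabelian.FundamentalExtension.CuspidalData.not_forall_nonProperIffFree
-- row 16 · AbsTopI:Lem4.5(iii) · F-0222 / F-0223 / F-0224 / F-0225
example := @AbsoluteAnabelian.AbsTopI.not_forall_lem45iii_cuspCount
example := @AbsoluteAnabelian.AbsTopI.not_forall_lem45iii_cycloClass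
example := @AbsoluteAnabelian.AbsTopI.not_forall_lem45iii_det
example := @AbsoluteAnabelian.AbsTopI.not_forall_realisedWeight
-- row 17 · AbsTopI:Lem4.5(iv) · F-0216
example := @AbsoluteAnabelian.FundamentalExtension.not_forall_satisfiesCuspidalCriterion
-- row 18 · AbsTopI:Lem4.5(v) · F-0206
example := @AbsoluteAnabelian.FundamentalExtension.CuspidalAlgorithm.not_forall_recoversCusps
-- row 19 · AbsTopI:Lem4.5(vi) · F-0207
example := @AbsoluteAnabelian.FundamentalExtension.CuspidalData.not_forall_decompEqCommensuratorOfInertia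
-- row 20 · AbsTopI:Prop4.10(i) · F-0256
example := @AbsoluteAnabelian.not_forall_prop410_i_ii_pointer

/-! ## §2 Surviving instance forms / conditional closers / `iff`-repairs (BY NAME) -/

-- row 1
example := @EtaleTheta.ThetaSetting.ThetaKummerInput.lem12_lineBundleData_of_deck
example := @EtaleTheta.ThetaFrobenioid.lem12_section5Reading_ofThetaSettingYddData
-- row 2
example := @EtaleTheta.ThetaSetting.ThetaKummerInput.prop11i_lineBundleData
-- row 3
example := @EtaleTheta.ThetaSetting.prop11ii_toy
example := @EtaleTheta.ThetaSetting.ThetaKummerInput.prop11ii_lineBundleDataLevel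
-- row 4 (instance of the vocabulary; C′ = the core form, already an `iff` in the tree; model instance)
example := @EtaleTheta.ThetaCovers.TemperedCoverData.extendsStabilising_refl
example := @EtaleTheta.ThetaCovers.TemperedCoverData.prop24_iff_core
example := @EtaleTheta.ThetaCovers.MonodromyModel.prop24_monodromyModel
-- row 5
example := @SemiGraphs.PSCDatum.edgeLikeIncidenceHolds_of_smoothProper
example := @SemiGraphs.PSCDatum.graphicIffEdgeLikeVerticialHolds_of_smoothCurve
example := @SemiGraphs.PSCDatum.graphicIffEdgeLikeVerticial_of_separating
-- row 6
example := @SemiGraphs.cor311_instance_injectiveNodesOnly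
example := @SemiGraphs.admissibleQuotientCompatible_instance_injectiveNodesOnly
example := @SemiGraphs.residueCharOfTemperedIso_instance_injectiveNodesOnly
example := @SemiGraphs.specialFibreIsoOfChartIso_instance_injectiveNodesOnly
-- row 7
example := @SemiGraphs.ex56CompactRigidityStatement_of_certifies_one
example := @SemiGraphs.ex56ObjectRecipeStatement_of_levelInputs
example := @SemiGraphs.ex56PropertiesStatement_of_levelInputs
-- row 8
example := @SemiGraphs.TemperedMorphismOrigin.temperedAnabelianTheoremHolds_of_tower
example := @SemiGraphs.TemperedCurve.geometricIsDFG_id_of_compactSpace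
example := @SemiGraphs.TemperedCurve.geometricIsGaloisCompatible_id
example := @SemiGraphs.TemperedCurve.outerDescent_of_toHat_surjective
-- row 9
example := @SemiGraphs.TemperedOrigin.temperedDecompositionGroupsHolds_of_profinite
-- row 10
example := @SemiGraphs.TemperedOrigin.cuspidalAbsolutenessHolds_of_cor311
-- row 11
example := @SemiGraphs.TemperedOrigin.profiniteOuterIsoLiftsHolds_of
-- row 12
example := @SemiGraphs.TemperedMorphismOrigin.dlocGroupTheoreticityHolds_of_genuine
example := @SemiGraphs.TemperedMorphismOrigin.dlocGroupTheoreticityGenuineHolds_of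
-- row 13
example := @SemiGraphs.isoInducesDLocEquivalence_of
-- row 14
example := @SemiGraphs.TemperedMorphismOrigin.decompositionPreservationHolds_of_parts
example := @SemiGraphs.TemperedTorsionOrigin.torsionPointsHolds_of_parts
-- row 15
example := @AbsoluteAnabelian.FundamentalExtension.CuspidalData.nonProperIffFree_splitFreeModel
example := @AbsoluteAnabelian.FundamentalExtension.CuspidalData.nonProperIffFree_of_isProSigmaCompletion_closedSurfaceGroup
-- row 16
example := @AbsoluteAnabelian.AbsTopI.lem45iii_cuspCount_splitModel
example := @AbsoluteAnabelian.AbsTopI.lem45iii_cycloClass_curveShape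
example := @AbsoluteAnabelian.AbsTopI.lem45iii_det_curveShape
example := @AbsoluteAnabelian.AbsTopI.realisedWeight_one
-- row 17
example := @AbsoluteAnabelian.FundamentalExtension.satisfiesCuspidalCriterion_cuspGp_of_smoothCurve
-- row 18
example := @AbsoluteAnabelian.FundamentalExtension.CuspidalAlgorithm.recoversCusps_of_out_eq
-- row 19
example := @AbsoluteAnabelian.FundamentalExtension.CuspidalData.decompEqCommensuratorOfInertia_of_isProSigmaCompletion
-- row 20
example := @AbsoluteAnabelian.prop410_i_ii_pointer_iff
example := @AbsoluteAnabelian.prop410_i_ii_pointer_of_piTempNormallyTerminal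

/-! ## §3 Row-10 note: `h65` (= `IsoPreservesCuspidalDecomp` at a pair of carriers) takes BOTH truth
values on the tree's semi-synthetic theta settings — true at `modelχ` / `model`, false at `modelκ′`
(the only `IsThm16Origin` model) — so the BY-NAME binder `h65` of the [IUTchII] §1 typings is a
genuineness hypothesis, dischargeable at no single semi-synthetic carrier of the K3 chain. -/

example := @EtaleTheta.SettingModel.modelχ_isoPreservesCuspidalDecomp
example := @EtaleTheta.SettingModel.model_isoPreservesCuspidalDecomp
example := @EtaleTheta.SettingModel.not_isoPreservesCuspidalDecomp_modelκ'
example := @EtaleTheta.SettingModel.isThm16Origin_and_forall_thm16i_and_not_h65_modelκ'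
example := @EtaleTheta.SettingModel.not_cuspidalAbsolutenessHolds_of_origin_modelκ'

/-! ## §4 Secondary names cited in RESCUE-39.md (toy / junk witnesses, conditional closers, `iff` forms,
consumer-side BY-NAME typings) — pinned so that every backticked decl of the table is certified to exist -/

-- Literature/IUT/HodgeArakelov/BadPlaceSettingOfDoubleUnderline.lean:238
example := @Literature.IUT.HodgeArakelov.TemperedCoverings.YL_eq_of_piYddCharacteristic
-- Literature/IUT/HodgeArakelov/TemperedCoveringsCharacteristic.lean:99
example := @Literature.IUT.HodgeArakelov.TemperedCoverings.YL_eq_of_prop24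
-- Literature/AnabelianGeometry/SemiGraphs/TemperedAnabelianThm64SubProofs.lean:43
example := @SemiGraphs.TemperedCurve.completionExtends_holds
-- Literature/AnabelianGeometry/SemiGraphs/TemperedAnabelianThm64SubProofs.lean:54
example := @SemiGraphs.TemperedCurve.completionOpenOfDOF_holds
-- Literature/AnabelianGeometry/SemiGraphs/TemperedSpecialFibreCor311Instances.lean:329
example := @SemiGraphs.cor311_of_certifies_injective_finite_nodesOnly
-- Literature/AnabelianGeometry/SemiGraphs/TemperedSpecialFibrePadicSchemaWitnesses.lean:186
example := @SemiGraphs.cor311_of_forall_not_isSpecialFibreOf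
-- Literature/AnabelianGeometry/SemiGraphs/TemperedSpecialFibreReductionsDescended.lean:91
example := @SemiGraphs.corollary_3_11_of_steps
-- Literature/AnabelianGeometry/SemiGraphs/TemperedCuspidalAbsolutenessOfProCusps.lean:246
example := @SemiGraphs.TemperedOrigin.cuspidalAbsolutenessHolds_of_levelwiseCuspGraphIso
-- Literature/AnabelianGeometry/SemiGraphs/TemperedDecompositionOfProfinite.lean:187
example := @SemiGraphs.TemperedCurve.decompDeterminesPoint_of_hat
-- Literature/AnabelianGeometry/SemiGraphs/TemperedAnabelianThm68Sub.lean:338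
example := @SemiGraphs.Thm68Sub.definedOverNumberFieldIff_of
-- Literature/AnabelianGeometry/SemiGraphs/TemperedDLocTransportEquivalence.lean:231
example := @SemiGraphs.TemperedMorphismOrigin.dlocEquivalenceClause_of
-- Literature/AnabelianGeometry/SemiGraphs/TemperedAnabelianThm68Sub.lean:119
example := @SemiGraphs.Thm68Sub.dlocEquivalence_of_parts
-- Literature/AnabelianGeometry/SemiGraphs/PSCGraphicityOriginClosure.lean:213
example := @SemiGraphs.PSCDatum.edgeLikeIncidenceHolds_empty
-- Literature/AnabelianGeometry/EtaleTheta/Discharge/Sec5Prop52iiSectionDefinedActions.lean:89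
example := @EtaleTheta.ThetaFrobenioid.existsUnique_fullAction_compatible_sCap_of_totallyEpi
-- Literature/AnabelianGeometry/SemiGraphs/TemperedTorsionPointsNonVacuity.lean:291
example := @SemiGraphs.TemperedTorsionOrigin.exists_allCertifying_torsionPointsHolds
-- Literature/AnabelianGeometry/SemiGraphs/ArithmeticCurvesEx56InstanceForms.lean:294
example := @SemiGraphs.StableReductionTower.exists_compatibleIsos_self
-- Literature/AnabelianGeometry/SemiGraphs/WitnessIwahoriCuspShear.lean:192
example := @SemiGraphs.IwahoriWitness.exists_cuspDatum_not_cor311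
-- Literature/AnabelianGeometry/EtaleTheta/ThetaTrivializationsToy.lean:89
example := @EtaleTheta.ThetaSetting.exists_lineBundleData_facts
-- Literature/AnabelianGeometry/EtaleTheta/ThetaTrivializationsOfFunctionsModelChi.lean:154
example := @EtaleTheta.SettingModel.exists_lineBundleData_lem12_modelχ
-- Literature/AnabelianGeometry/EtaleTheta/ThetaTrivializationsClosures.lean:57
example := @EtaleTheta.ThetaSetting.exists_lineBundleData_not_facts
-- Literature/AnabelianGeometry/AbsoluteAnabelian/AbsTopIChainsCuspidalFacts.lean:270
example := @AbsoluteAnabelian.FundamentalExtension.exists_nontrivial_arith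
-- Literature/AnabelianGeometry/SemiGraphs/TemperedSpecialFibrePadicSchemaWitnesses.lean:153
example := @SemiGraphs.exists_not_cor311
-- Literature/AnabelianGeometry/SemiGraphs/TemperedOriginSchemaNegative.lean:176
example := @SemiGraphs.TemperedCurve.exists_not_decompDeterminesPoint
-- Literature/AnabelianGeometry/AbsoluteAnabelian/AbsTopIChainsCuspidalFacts.lean:223
example := @AbsoluteAnabelian.FundamentalExtension.CuspidalData.exists_not_decompEqCommensuratorOfInertia
-- Literature/AnabelianGeometry/SemiGraphs/ArithmeticCurvesEx56SchemaVerdicts.lean:214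
example := @SemiGraphs.exists_not_ex56Statements
-- Literature/AnabelianGeometry/SemiGraphs/PSCGraphicityOriginClosure.lean:221
example := @SemiGraphs.PSCDatum.exists_not_graphicIffEdgeLikeVerticial
-- Literature/AnabelianGeometry/SemiGraphs/TemperedOriginSchemaNegative.lean:228
example := @SemiGraphs.TemperedCurve.exists_not_isoPreservesCuspidalDecomp
-- Literature/AnabelianGeometry/AbsoluteAnabelian/AbsTopIChainsCuspidalFacts.lean:235
example := @AbsoluteAnabelian.FundamentalExtension.CuspidalData.exists_not_nonProperIffFree
-- Literature/AnabelianGeometry/AbsoluteAnabelian/AbsTopITemperedCuspsFactRows.lean:253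
example := @AbsoluteAnabelian.exists_not_prop410_i_ii_pointer
-- Literature/AnabelianGeometry/AbsoluteAnabelian/AbsTopIChainsCuspidalFacts.lean:250
example := @AbsoluteAnabelian.FundamentalExtension.CuspidalAlgorithm.exists_not_recoversCusps
-- Literature/AnabelianGeometry/SemiGraphs/TemperedCuspidalAbsolutenessOfCor311.lean:269
example := @SemiGraphs.TemperedOrigin.exists_principal_cor311Leaves
-- Literature/AnabelianGeometry/AbsoluteAnabelian/AbsTopIGraphCuspidalNonVacuity.lean:255
example := @AbsoluteAnabelian.FundamentalExtension.CuspidalAlgorithm.exists_recoversCusps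
-- Literature/AnabelianGeometry/SemiGraphs/TemperedAnabelianThm64SubOuterDescentNegative.lean:121
example := @SemiGraphs.exists_temperedCurve_not_outerDescent
-- Literature/AnabelianGeometry/EtaleTheta/Discharge/Sec2Prop26InstanceForms.lean:222
example := @EtaleTheta.ThetaCovers.TemperedCoverData.extendsStabilising_dotted_refl
-- Literature/AnabelianGeometry/SemiGraphs/TemperedAnabelianThm64SubIdentityDatumNegative.lean:73
example := @SemiGraphs.TemperedCurve.geometricIsGaloisCompatible_id_settingModel
-- Literature/AnabelianGeometry/SemiGraphs/PSCGraphicitySmoothProperInstances.lean:174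
example := @SemiGraphs.PSCDatum.graphicIffEdgeLikeVerticial_genusTwoProper
-- Literature/AnabelianGeometry/SemiGraphs/TemperedDecompositionInternal.lean:139
example := @SemiGraphs.TemperedCurve.inertiaDeterminesCusp_of_decompDeterminesPoint
-- Literature/AnabelianGeometry/AbsoluteAnabelian/AbsTopICuspInertiaOfPSCLem45iv.lean:71
example := @AbsoluteAnabelian.FundamentalExtension.CuspInertiaData.isCuspidal_iff_isMaximalCuspidalCandidate
-- Literature/AnabelianGeometry/AbsoluteAnabelian/FreeProSigmaCompletionBridge.lean:204
example := @AbsoluteAnabelian.isFreeProOn_of_isProSigmaCompletion_lift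
-- Literature/AnabelianGeometry/AbsoluteAnabelian/FreeProSigmaNonVacuity.lean:64
example := @AbsoluteAnabelian.isFreePro_profiniteCompletion_freeGroup
-- Literature/AnabelianGeometry/AbsoluteAnabelian/AbsTopICuspInertiaOfPSCSmoothCurve.lean:253
example := @AbsoluteAnabelian.FundamentalExtension.isMaximalCuspidalCandidate_cuspGp_of_smoothCurve
-- Literature/IUT/HodgeArakelov/TemperedCoveringsCharacteristic.lean:62
example := @Literature.IUT.HodgeArakelov.BadPlaceSetting.isTopCharacteristic_refY_refYdd_of_prop24
-- Literature/AnabelianGeometry/SemiGraphs/TemperedDLocTransportEquivalence.lean:215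
example := @SemiGraphs.isoInducesDLocEquivalence_of_thm65iii
-- Literature/AnabelianGeometry/SemiGraphs/TemperedCurveHyperbolicWitness.lean:338
example := @SemiGraphs.TemperedCurve.isoInducesDLocEquivalence_toyHyperbolic_refl
-- Literature/AnabelianGeometry/SemiGraphs/TemperedDLocTypePreservedProofs.lean:240
example := @SemiGraphs.Thm68Sub.isoPreservesTemperedDLocType_of
-- Literature/AnabelianGeometry/SemiGraphs/TemperedAnabelianThm68OriginClosers.lean:199
example := @SemiGraphs.TemperedMorphismOrigin.isoPreservesTorsionDecomp_of_parts
-- Literature/AnabelianGeometry/EtaleTheta/ThetaTrivializationsClosures.lean:146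
example := @EtaleTheta.ThetaSetting.lem12_independent_of_setting
-- Literature/AnabelianGeometry/EtaleTheta/ThetaTrivializationsOfFunctionsLevel.lean:193
example := @EtaleTheta.ThetaSetting.ThetaKummerInput.lem12_lineBundleDataLevel
-- Literature/AnabelianGeometry/EtaleTheta/ThetaTrivializationsToy.lean:79
example := @EtaleTheta.ThetaSetting.lem12_toy
-- Literature/AnabelianGeometry/AbsoluteAnabelian/AbsTopICharacterRankSplitModel.lean:375
example := @AbsoluteAnabelian.AbsTopI.Int42Model.lem45iii_all
-- Literature/AnabelianGeometry/AbsoluteAnabelian/AbsTopICharacterRankProperShape.lean:196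
example := @AbsoluteAnabelian.AbsTopI.lem45iii_cuspCount_properShape_one
-- Literature/AnabelianGeometry/AbsoluteAnabelian/AbsTopICharacterRankPoincareExtension.lean:280
example := @AbsoluteAnabelian.AbsTopI.lem45iii_cycloClass_of_poincareExtension
-- Literature/AnabelianGeometry/AbsoluteAnabelian/AbsTopICharacterRankLem45iiiClosures.lean:143
example := @AbsoluteAnabelian.AbsTopI.lem45iii_det_of_detChar_eq
-- Literature/AnabelianGeometry/AbsoluteAnabelian/AbsTopICharacterRankPoincareExtension.lean:263
example := @AbsoluteAnabelian.AbsTopI.lem45iii_det_of_poincareExtension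
-- Literature/AnabelianGeometry/SemiGraphs/TemperedDLocGenuineSchemaNegative.lean:136
example := @SemiGraphs.DLocObj.not_dLocEquivalence_toyHyperbolic
-- Literature/AnabelianGeometry/SemiGraphs/TemperedOriginSchemaNegative.lean:198
example := @SemiGraphs.TemperedCurve.not_decompCommensurablyTerminal_toyHyperbolic
-- Literature/AnabelianGeometry/SemiGraphs/TemperedOriginSchemaNegative.lean:170
example := @SemiGraphs.TemperedCurve.not_decompDeterminesPoint_of_eq
-- Literature/AnabelianGeometry/SemiGraphs/TemperedAnabelianThm64SubSchemas.lean:151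
example := @SemiGraphs.TemperedCurve.not_forall_geometricIsGaloisCompatible
-- Literature/AnabelianGeometry/SemiGraphs/TemperedCurveDiscreteRankOneWitness.lean:281
example := @SemiGraphs.not_forall_piTempNormallyTerminal
-- Literature/AnabelianGeometry/SemiGraphs/TemperedCurveDiscreteRankOneWitness.lean:294
example := @SemiGraphs.not_forall_profiniteOuterIsoLifts
-- Literature/AnabelianGeometry/SemiGraphs/TemperedAnabelianThm64SubSchemas.lean:109
example := @SemiGraphs.TemperedCurve.not_geometricIsDFG_trivial
-- Literature/AnabelianGeometry/AbsoluteAnabelian/AbsTopILem45iModelProofs.lean:154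
example := @AbsoluteAnabelian.not_isFreePro_of_isProSigmaCompletion_surfaceGroup
-- Literature/AnabelianGeometry/AbsoluteAnabelian/AbsTopICharacterRankProperShape.lean:205
example := @AbsoluteAnabelian.AbsTopI.not_lem45iii_cuspCount_properShape_zero
-- Literature/AnabelianGeometry/AbsoluteAnabelian/AbsTopICharacterRankLem45iiiClosures.lean:89
example := @AbsoluteAnabelian.AbsTopI.not_lem45iii_cycloClass_one
-- Literature/AnabelianGeometry/AbsoluteAnabelian/AbsTopICharacterRankLem45iiiClosures.lean:123
example := @AbsoluteAnabelian.AbsTopI.not_lem45iii_det_one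
-- Literature/IUT/LogThetaLattice/MultiradialityRemarksRmk212iiAtTemperedModels.lean:238
example := @Literature.IUT.LogThetaLattice.MultiradialityRemarks.not_piTempNormallyTerminal_curveχ
-- Literature/AnabelianGeometry/SemiGraphs/TemperedTorsionPointsSchemaNegative.lean:149
example := @SemiGraphs.TemperedCurve.not_preservesDecompOf_refl
-- Literature/AnabelianGeometry/EtaleTheta/Discharge/Sec2Prop26NoExtensionOfHatConj.lean:168
example := @EtaleTheta.ThetaCovers.TemperedCoverData.not_prop24_of_hatConj
-- Literature/AnabelianGeometry/AbsoluteAnabelian/AbsTopICharacterRankLem45iiiClosures.lean:230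
example := @AbsoluteAnabelian.AbsTopI.not_realisedWeight_id_rat_one
-- Literature/AnabelianGeometry/AbsoluteAnabelian/AbsTopIChainsSchemaClosures.lean:256
example := @AbsoluteAnabelian.FundamentalExtension.not_satisfiesCuspidalCriterion_bot
-- Literature/AnabelianGeometry/SemiGraphs/TemperedAnabelianThm64SubProofs.lean:65
example := @SemiGraphs.TemperedCurve.outerDescent_of_openDenseDOFConjugator
-- Literature/AnabelianGeometry/SemiGraphs/TemperedAnabelianThm68ivAssembly.lean:98
example := @SemiGraphs.Thm68Sub.preservesDecompOf_algebraic_of_tripodBelyi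
-- Literature/AnabelianGeometry/SemiGraphs/TemperedOriginSchemaNegative.lean:127
example := @SemiGraphs.TemperedCurve.profiniteOuterIsoLifts_degenerate
-- Literature/AnabelianGeometry/SemiGraphs/TemperedAnabelianThm66SubProofs.lean:200
example := @SemiGraphs.TemperedCurve.profiniteOuterIsoLifts_of_system
-- Literature/AnabelianGeometry/EtaleTheta/ThetaTrivializationsClosures.lean:112
example := @EtaleTheta.ThetaSetting.prop11i_independent_of_setting
-- Literature/AnabelianGeometry/EtaleTheta/ThetaTrivializationsOfFunctionsLevel.lean:130
example := @EtaleTheta.ThetaSetting.ThetaKummerInput.prop11i_lineBundleDataLevel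
-- Literature/AnabelianGeometry/EtaleTheta/ThetaTrivializationsToy.lean:64
example := @EtaleTheta.ThetaSetting.prop11i_toy
-- Literature/AnabelianGeometry/AbsoluteAnabelian/AbsTopIProp410iiNodeReclose.lean:84
example := @AbsoluteAnabelian.prop410_i_ii_pointer
-- Literature/AnabelianGeometry/AbsoluteAnabelian/AbsTopITemperedCuspsFactRows.lean:223
example := @AbsoluteAnabelian.prop410_i_ii_pointer_degenerate
-- Literature/AnabelianGeometry/AbsoluteAnabelian/AbsTopITemperedCuspsFactRows.lean:260
example := @AbsoluteAnabelian.prop410_i_ii_pointer_independent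
-- Literature/AnabelianGeometry/AbsoluteAnabelian/AbsTopITemperedCuspsFactRows.lean:172
example := @AbsoluteAnabelian.prop410_i_injective
-- Literature/AnabelianGeometry/AbsoluteAnabelian/AbsTopIChainsRecoversCuspsInstances.lean:61
example := @AbsoluteAnabelian.FundamentalExtension.CuspidalAlgorithm.recoversCusps_emptyAlgorithm
-- Literature/AnabelianGeometry/AbsoluteAnabelian/AbsTopIChainsRecoversCuspsInstances.lean:51
example := @AbsoluteAnabelian.FundamentalExtension.CuspidalAlgorithm.recoversCusps_of_out_eq_empty
-- Literature/AnabelianGeometry/SemiGraphs/TemperedSpecialFibreInertiaTransport.lean:364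
example := @SemiGraphs.residueCharOfTemperedIso_of_inertia
-- Literature/AnabelianGeometry/AbsoluteAnabelian/AbsTopIChainsSchemaClosures.lean:279
example := @AbsoluteAnabelian.FundamentalExtension.satisfiesCuspidalCriterion_top_padicInt
-- Literature/AnabelianGeometry/SemiGraphs/TemperedAnabelianThm64SubCoveringDatum.lean:378
example := @SemiGraphs.TemperedCurve.temperedAnabelianTheorem_covering_of_specialFibreTower_of_eventually_singular
-- Literature/AnabelianGeometry/EtaleTheta/Discharge/Sec5Prop52iiSectionDefinedActions.lean:129
example := @EtaleTheta.ThetaFrobenioid.thetaPairActionsAgree_sectionDefined_of_totallyEpi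
-- Literature/AnabelianGeometry/SemiGraphs/TemperedTorsionPointsNonVacuity.lean:281
example := @SemiGraphs.TemperedTorsionOrigin.torsionPointsHolds_of_forall_not_isFlagsOrigin
-- Literature/AnabelianGeometry/SemiGraphs/TemperedCurvePuncturedDiscNonVacuity.lean:159
example := @SemiGraphs.TemperedCurve.isoPreservesCuspidalDecomp_of_disc
-- Literature/AnabelianGeometry/SemiGraphs/TemperedOriginCompletionSchemaNegative.lean:90
example := @SemiGraphs.TemperedCurve.not_forall_prime_profiniteOuterIsoLiftsHolds
-- Literature/AnabelianGeometry/AbsoluteAnabelian/AbsTopICuspInertiaOfPSCSmoothCurve.lean:378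
example := @AbsoluteAnabelian.FundamentalExtension.exists_satisfiesCuspidalCriterion_genuine
-- Literature/AnabelianGeometry/EtaleTheta/Discharge/Sec5Lem12AtSection5Reading.lean:111
example := @EtaleTheta.ThetaFrobenioid.lem12b_existsUnique_tauAction_ofThetaSettingYddData
-- Literature/AnabelianGeometry/EtaleTheta/Discharge/Sec5Lem12AtSection5Reading.lean:128
example := @EtaleTheta.ThetaFrobenioid.lem12c_tauAction_eq_mu_mul_sAction_ofThetaSettingYddData
-- Literature/AnabelianGeometry/AbsoluteAnabelian/AbsTopICharacterRankCyclotomicModel.lean:252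
example := @AbsoluteAnabelian.AbsTopI.lem45iii_cycloClass_cycloModel
-- Literature/AnabelianGeometry/EtaleTheta/SettingModelKrullCuspNotIsoPreservesCuspidal.lean:103
example := @EtaleTheta.SettingModel.exists_deltaPreserving_not_preserves_cuspidal_modelκ'
-- Literature/AnabelianGeometry/EtaleTheta/Discharge/Sec2Prop26FalseAtModelKrull.lean:277
example := @EtaleTheta.SettingModel.not_prop24_temperedCoverData_inversionModelκ'
-- Literature/AnabelianGeometry/SemiGraphs/PSCTwoTripodIncidence.lean:183
example := @SemiGraphs.PSCDatum.edgeLikeIncidenceHolds_of_twoTripod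
-- Literature/AnabelianGeometry/SemiGraphs/PSCSmoothCurveShape.lean:250
example := @SemiGraphs.PSCDatum.edgeLikeIncidenceHolds_of_vertGp_eq_top
-- Literature/AnabelianGeometry/SemiGraphs/TemperedAnabelianThm64SubProofs.lean:97
example := @SemiGraphs.TemperedMorphismOrigin.temperedAnabelianTheoremHolds_of_inputs
-- Literature/AnabelianGeometry/SemiGraphs/ArithmeticCurvesEx56SchemaVerdicts.lean:358
example := @SemiGraphs.ex56CompactRigidityStatement_of_forall_not
-- Literature/AnabelianGeometry/AbsoluteAnabelian/CuspidalDataNonProperIffFreeInstances.lean:112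
example := @AbsoluteAnabelian.FundamentalExtension.CuspidalData.nonProperIffFree_splitClosedSurfaceModel
-- Literature/AnabelianGeometry/AbsoluteAnabelian/CuspidalDataNonProperIffFreeInstances.lean:167
example := @AbsoluteAnabelian.FundamentalExtension.CuspidalData.nonProperIffFree_splitFreeTwoModel_rat
-- Literature/AnabelianGeometry/SemiGraphs/TemperedAnabelianThm68OriginClosers.lean:166
example := @SemiGraphs.TemperedMorphismOrigin.dlocGroupTheoreticityHolds_of_parts
-- Literature/AnabelianGeometry/SemiGraphs/TemperedAnabelianThm68OriginClosers.lean:125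
example := @SemiGraphs.TemperedMorphismOrigin.dlocGroupTheoreticityGenuineHolds_of_parts
-- Literature/AnabelianGeometry/SemiGraphs/TemperedDecompositionInternal.lean:196
example := @SemiGraphs.TemperedOrigin.temperedDecompositionGroupsHolds_of_profinite₄
-- Literature/AnabelianGeometry/SemiGraphs/TemperedSec6OfSpecialFibreTowerEventually.lean:271
example := @SemiGraphs.TemperedOrigin.profiniteOuterIsoLiftsHolds_of_specialFibreTower_of_eventually_singular
-- Literature/AnabelianGeometry/SemiGraphs/TemperedAnabelianSec6OfTowerProofs.lean:323
example := @SemiGraphs.TemperedOrigin.profiniteOuterIsoLiftsHolds_of_tower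
-- Literature/AnabelianGeometry/AbsoluteAnabelian/AbsTopIProp410iiNodeReclose.lean:115
example := @AbsoluteAnabelian.prop410_i_ii_pointer_of_compactSpace
-- Literature/AnabelianGeometry/AbsoluteAnabelian/AbsTopIChainsCuspidalFacts.lean:151
example := @AbsoluteAnabelian.FundamentalExtension.CuspidalData.decompEqCommensuratorOfInertia_of_inertiaCommensurablyTerminal_of_decompEqNormalizer
-- Literature/AnabelianGeometry/SemiGraphs/TemperedAnabelianThm68OriginClosersCor69.lean:50
example := @SemiGraphs.TemperedMorphismOrigin.decompositionPreservationHolds_of_parts_of_sectionCriterion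
-- Literature/IUT/HodgeArakelov/ThetaSettingModelTateNotNormallyTerminal.lean:82 (row 20: (ii) FAILS at `curveχq p i j`, every `p i j`)
example := @EtaleTheta.SettingModel.not_piTempNormallyTerminal_curveχq
-- Literature/IUT/HodgeArakelov/ThetaSettingModelTateNotDeltaNormallyTerminal.lean:86
example := @EtaleTheta.SettingModel.not_deltaTempNormallyTerminal_curveχq

/-! ## §5 Floor of record (ERRATUM g12-E1; cited BY NAME in §2 of the memo; (P)-arm, numeric on `NFPoint`) -/

-- Summits/ABC/IUTFork/LDHGenuinePerImageContentfulAll.lean:230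
example := @Summit.ABC.IUTFork.PointDict.szpiro_of_cor312PerImageAtDatum_six_all
-- Summits/ABC/IUTFork/LDHGenuinePerImageContentfulAll.lean:261
example := @Literature.IUT.LogVolume.Cor22.cor312PerImageAtDatum_sandwich_dmod_one_all

end Summit.ABC.ABC.Cruxes.ThetaPartII.Rescue39A
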